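import Summits.Ventures.CertifiedArithmetic.LowPrec.SRSaturationIntervals
import Summits.Ventures.CertifiedArithmetic.LowPrec.SRFormatsBridge
import HarnessLib

/-!
# SR summation trees XV — a purely RATIONAL saturation certificate (no `Real.exp`; kernel-decidable)

HONEST FRAMING: certified error envelopes and provably optimal rounding/accumulation schemes for
low-precision formats under stated cost models; every table by two implementations; no hardware or
vendor claims.

File XIV (`SRSaturationIntervals`) certifies `P(sat) ≤ satBoundI F' lo hi T = Σ_{v : S_v ≠ 0}
2·exp(−2d_v²/S_v)`, a real number.  Here the exponential is replaced by Euler's rational upper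
bound `e^{−x} ≤ (1 + x/k)^{−k}` (`x ≥ 0`, any `k`; from `1 + y ≤ e^y`, Mathlib
`Real.add_one_le_exp`;
relative slack `≈ x²/(2k)`, i.e. below 2 % for `k = 1024` and `x ≤ 6` — equivalently wherever
`2e^{−x} ≥ 0.005`, the only range in which the slack matters; measured ≤ 0.5 % on the tables), giving

* `expNegUB x k`, `nodeBoundQ`, `satBoundIQ F' lo hi k T : ℚ` — computable by structural recursion
  over the tree from the interval certificate `envI` of file IX, decidable in the kernel
  (`k` a power of two: `k` squarings of a rational);
* `satBoundI_le_satBoundIQ` — `satBoundI ≤ satBoundIQ` under headroom;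
* `satProbT_le_satBoundIQ` — **an inequality between two rationals**:
  `satProbT F T ≤ satBoundIQ (extendBy F lo hi G (m−1)) lo hi k T` for every `F` with `HullData`,
  every tree with headroom `h > 0` and every `k`; `format_satProbT_le_IQ` for every `Format`.

So a saturation certificate for a concrete accumulation is now a closed rational term that Lean
EVALUATES, while the inequality it certifies is a theorem for all inputs at once.  Kernel instances
(section `Kernel`): the row `−6, 3/2, 3/2, −1/2` of `certs/sr/gen4/SATIQ_e2m1_seq4_k1024_{A,B}.csv`
(`psat = 1/16`, `h = 3/2`, bound `0.442160436028 < satBoundIQ ≤ 0.442160436029` — the third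
implementation of that column besides `code/sr/gen4/srsatI_A.py` / `srsatI_B.py`), and two FP8 sums
no enumeration reaches: E4M3, data `1 + (i mod 8)/8`, balanced, `n = 16` (`P(sat) ≤ 10⁻⁶⁰`) and
`n = 64` (`2⁶³` branches; `P(sat) ≤ 10⁻³⁸`), each ONE `theorem` obtained from
`satProbT_le_satBoundIQ` and `decide +kernel`.
-/

namespace Summit.Ventures.CertifiedArithmetic.LowPrec.SR

open Literature.ComputerArithmetic.ConnollyHighamMary2021
open Literature.ComputerArithmetic.FloatingPoint
open Finset Real STree

/-! ### A rational upper bound of `exp (−x)` -/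

/-- `expNegUB x k = (1 + x/k)^{−k}` (Euler's lower bound of `eˣ`, inverted). -/
def expNegUB (x : ℚ) (k : ℕ) : ℚ := 1 / (1 + x / k) ^ k

/-- `(1 + x/k)^k ≤ eˣ` for `x ≥ 0`. -/
theorem one_add_div_pow_le_exp {x : ℝ} (hx : 0 ≤ x) (k : ℕ) : (1 + x / k) ^ k ≤ exp x := by
  rcases Nat.eq_zero_or_pos k with hk | hk
  · subst hk
    rw [pow_zero]
    exact Real.one_le_exp hx
  · calc (1 + x / k) ^ k ≤ (exp (x / k)) ^ k :=
          pow_le_pow_left₀ (by positivity) (by linarith [Real.add_one_le_exp (x / k)]) k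
      _ = exp x := by
          rw [← Real.exp_nat_mul]
          congr 1
          field_simp

/-- `e^{−x} ≤ expNegUB x k` for `x ≥ 0`. -/
theorem exp_neg_le_expNegUB {x : ℚ} (hx : 0 ≤ x) (k : ℕ) :
    exp (-(x : ℝ)) ≤ (expNegUB x k : ℝ) := by
  have h1 := one_add_div_pow_le_exp (x := (x : ℝ)) (by exact_mod_cast hx) k
  have hpos : 0 < (1 + (x : ℝ) / k) ^ k := by positivity
  unfold expNegUB
  rw [Real.exp_neg]
  push_cast
  rw [one_div]
  exact inv_anti₀ hpos h1

/-! ### The rational node bound and tree bound -/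

/-- `nodeBoundQ k S d = [S ≠ 0] · 2 · expNegUB (2d²/S) k ≥ nodeBoundS S d`. -/
def nodeBoundQ (k : ℕ) (S d : ℚ) : ℚ := if S = 0 then 0 else 2 * expNegUB (2 * d ^ 2 / S) k

/-- `nodeBoundS ≤ nodeBoundQ` for a nonnegative variance proxy and positive headroom. -/
theorem nodeBoundS_le_nodeBoundQ (k : ℕ) {S d : ℚ} (hS : 0 ≤ S) (hd : 0 < d) :
    nodeBoundS (S : ℝ) (d : ℝ) ≤ (nodeBoundQ k S d : ℝ) := by
  unfold nodeBoundS nodeBoundQ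
  by_cases h0 : S = 0
  · subst h0; simp
  · have hS' : (S : ℝ) ≠ 0 := by exact_mod_cast h0
    rw [if_neg hS', if_neg h0]
    have hx : 0 ≤ 2 * d ^ 2 / S := by positivity
    have hexp := exp_neg_le_expNegUB hx k
    have hcast : -2 * (d : ℝ) ^ 2 / (S : ℝ) = -((2 * d ^ 2 / S : ℚ) : ℝ) := by
      push_cast; ring
    have h2 : ((2 * expNegUB (2 * d ^ 2 / S) k : ℚ) : ℝ)
        = 2 * (expNegUB (2 * d ^ 2 / S) k : ℝ) := by
      push_cast; ring
    rw [hcast, h2]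
    linarith

/-- **`satBoundIQ F' lo hi k T`**: the rational adaptive saturation bound — `satBoundI` with every
`2e^{−2d_v²/S_v}` replaced by `nodeBoundQ k S_v d_v`. -/
def satBoundIQ (F' : Finset ℚ) (lo hi : ℚ) (k : ℕ) : STree ℚ → ℚ
  | .leaf _ => 0
  | .node l r => satBoundIQ F' lo hi k l + satBoundIQ F' lo hi k r
      + nodeBoundQ k (4 * (envI F' l + envI F' r)) (room lo hi (l.exact + r.exact))

/-- The interval variance certificate is nonnegative. -/
theorem envI_nonneg (F : Finset ℚ) : ∀ T : STree ℚ, 0 ≤ envI F T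
  | .leaf _ => by simp [envI]
  | .node l r => by
      simp only [envI]
      have := envI_nonneg F l
      have := envI_nonneg F r
      positivity

/-- `satBoundI ≤ satBoundIQ` along a tree with positive headroom. -/
theorem satBoundI_le_satBoundIQ (F' : Finset ℚ) {lo hi h : ℚ} (hh : 0 < h) (k : ℕ) :
    ∀ T : STree ℚ, HeadroomT lo hi h T → satBoundI F' lo hi T ≤ (satBoundIQ F' lo hi k T : ℝ)
  | .leaf _, _ => by simp [satBoundI, satBoundIQ]
  | .node l r, ⟨hl, hr, h1, h2⟩ => by
      simp only [satBoundI, satBoundIQ]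
      rw [Rat.cast_add, Rat.cast_add]
      have hd : 0 < room lo hi (l.exact + r.exact) := by
        unfold room; exact lt_min (by linarith) (by linarith)
      have hS : 0 ≤ 4 * (envI F' l + envI F' r) := by
        have := envI_nonneg F' l
        have := envI_nonneg F' r
        positivity
      have hn := nodeBoundS_le_nodeBoundQ k hS hd
      have ihl := satBoundI_le_satBoundIQ F' hh k l hl
      have ihr := satBoundI_le_satBoundIQ F' hh k r hr
      linarith

/-! ### The rational certificate -/

/-- **The rational saturation certificate**: for `F` with `HullData F lo hi G` and a tree whose
exact partial sums have headroom `h > 0`, for every `k`,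
`satProbT F T ≤ satBoundIQ (extendBy F lo hi G (m − 1)) lo hi k T` — both sides rational. -/
theorem satProbT_le_satBoundIQ {F : Finset ℚ} {lo hi G : ℚ} (hB : HullData F lo hi G) {h : ℚ}
    (hh : 0 < h) (T : STree ℚ) (hT : HeadroomT lo hi h T) (k : ℕ) :
    satProbT F T ≤ satBoundIQ (extendBy F lo hi G (T.nodes - 1)) lo hi k T := by
  have h1 := satProbT_le_satBoundI hB hh T hT
  have h2 := satBoundI_le_satBoundIQ (extendBy F lo hi G (T.nodes - 1)) hh k T hT
  exact_mod_cast h1.trans h2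

/-- **Every format**: `satProbT (valueSet φ) T ≤ satBoundIQ F' (−maxRat) maxRat k T` with
`F' = extendBy (valueSet φ) (−maxRat) maxRat (topGap φ) (m − 1)`, under headroom `h > 0`. -/
theorem format_satProbT_le_IQ (φ : Format) {h : ℚ} (hh : 0 < h) (T : STree ℚ)
    (hT : HeadroomT (-φ.maxRat) φ.maxRat h T) (k : ℕ) :
    satProbT (MiniFloat.valueSet φ) T
      ≤ satBoundIQ (extendBy (MiniFloat.valueSet φ) (-φ.maxRat) φ.maxRat (topGap φ) (T.nodes - 1))
          (-φ.maxRat) φ.maxRat k T :=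
  satProbT_le_satBoundIQ (hullData_valueSet φ) hh T hT k

/-- The tail / bias / mean-square corollaries of file XIV with the rational saturation term. -/
theorem sq_err_le_IQ {F : Finset ℚ} {lo hi G : ℚ} (hB : HullData F lo hi G) {h : ℚ} (hh : 0 < h)
    (T : STree ℚ) (hT : HeadroomT lo hi h T) (k : ℕ) :
    ((treeExp F T (fun v => (v - T.exact) ^ 2) : ℚ) : ℝ)
      ≤ ((envI (extendBy F lo hi G (T.nodes - 1)) T : ℚ) : ℝ)
        + ((max (hi - lo) (T.nodes * G) : ℚ) : ℝ) ^ 2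
          * (satBoundIQ (extendBy F lo hi G (T.nodes - 1)) lo hi k T : ℝ) := by
  have h1 := sq_err_le_I hB hh T hT
  have h2 := satBoundI_le_satBoundIQ (extendBy F lo hi G (T.nodes - 1)) hh k T hT
  have hR : 0 ≤ ((max (hi - lo) (T.nodes * G) : ℚ) : ℝ) ^ 2 := sq_nonneg _
  nlinarith

/-! ### Concrete hull data for the FP4 / FP8 literals -/

/-- E2M1: hull `[−6, 6]`, top gap `2`. -/
theorem hullData_e2m1 : HullData FP4.e2m1 (-6) 6 2 := by
  have h1 : Format.E2M1.maxRat = 6 := by decide +kernel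
  have h2 : topGap Format.E2M1 = 2 := by decide +kernel
  have h := hullData_valueSet Format.E2M1
  rw [← e2m1_eq_valueSet, h1, h2] at h
  exact h

/-- E4M3 (OCP finite data): hull `[−448, 448]`, top gap `32`. -/
theorem hullData_e4m3 : HullData Formats.e4m3 (-448) 448 32 := by
  have h1 : Format.E4M3.maxRat = 448 := by decide +kernel
  have h2 : topGap Format.E4M3 = 32 := by decide +kernel
  have h := hullData_valueSet Format.E4M3
  rw [← e4m3_eq_valueSet, h1, h2] at h
  exact h

/-! ### Kernel instances: rows of `certs/sr/gen4/SATIQ_e2m1_seq4_k1024_{A,B}.csv` and FP8 cases -/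

namespace Kernel

/-- The E2M1 row `−6, 3/2, 3/2, −1/2` of `SATIQ_e2m1_seq4_k1024` (left comb). -/
def t4 : STree ℚ := .node (.node (.node (.leaf (-6)) (.leaf (3/2))) (.leaf (3/2))) (.leaf (-1/2))

/-- Its exact saturation probability `1/16` and headroom `3/2` (columns `psat`, `h`). -/
theorem t4_psat_headroom : satProbT FP4.e2m1 t4 = 1/16 ∧ HeadroomT (-6 : ℚ) 6 (3/2) t4 := by
  decide +kernel

/-- Its rational certificate with Euler parameter `k = 1024`, to 12 digits: the table prints the
upward rounding `4.42160436029E-01` (third implementation of that column). -/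
theorem t4_satBoundIQ :
    442160436028 / 10 ^ 12 < satBoundIQ (extendBy FP4.e2m1 (-6) 6 2 2) (-6) 6 1024 t4
      ∧ satBoundIQ (extendBy FP4.e2m1 (-6) 6 2 2) (-6) 6 1024 t4 ≤ 442160436029 / 10 ^ 12 := by
  decide +kernel

/-- **The certificate in action** (no enumeration of branches): `P(sat) ≤ 4.42160436029E-01` for
that row, from `satProbT_le_satBoundIQ` and a kernel evaluation of the rational bound. -/
theorem t4_certified : satProbT FP4.e2m1 t4 ≤ 442160436029 / 10 ^ 12 :=
  (satProbT_le_satBoundIQ hullData_e2m1 (by norm_num : (0 : ℚ) < 3 / 2) t4 t4_psat_headroom.2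
    1024).trans (by decide +kernel)

/-- **E4M3, 16 leaves `1 + (i mod 8)/8`, balanced** (`2¹⁵` branches; case `e4m3:saw8:bal n=16` of
`SATI_cases`): headroom `425`, and with Euler parameter `k = 16` the rational certificate gives
`P(sat) ≤ 10⁻⁶⁰` — by theorem + kernel evaluation, no enumeration. -/
theorem e4m3_bal16_certified :
    satProbT Formats.e4m3 (balT Trees.saw 0 4) ≤ 1 / 10 ^ 60 :=
  (satProbT_le_satBoundIQ hullData_e4m3 (by norm_num : (0 : ℚ) < 425) (balT Trees.saw 0 4)
    (by decide +kernel) 16).trans (by decide +kernel)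

/-- **E4M3, 64 leaves `1 + (i mod 8)/8`, balanced** (`2⁶³` branches — no enumeration possible;
case `e4m3:saw8:bal n=64`): headroom `356`, `P(sat) ≤ 10⁻³⁸` with Euler parameter `k = 16`. -/
theorem e4m3_bal64_certified :
    satProbT Formats.e4m3 (balT Trees.saw 0 6) ≤ 1 / 10 ^ 38 :=
  (satProbT_le_satBoundIQ hullData_e4m3 (by norm_num : (0 : ℚ) < 356) (balT Trees.saw 0 6)
    (by decide +kernel) 16).trans (by decide +kernel)

end Kernel

end Summit.Ventures.CertifiedArithmetic.LowPrec.SR
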